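import Literature.Barriers.ValiantsHypothesis.BDGIL24WeightProjectorsEuler
import Literature.Computability.AlgebraicComplexity.LMR13TangentIsotypic
import HarnessLib

/-!
# The action of `gl_k` on metapolynomials by derivations ([BDGIL24, §4, Claim 4.2; §5]) —
# `BergEtAl2024.lieOp`, a Lie algebra representation whose Cartan part is `eulerOp` — PROVED

[BDGIL24] = M. van den Berg, P. Dutta, F. Gesmundo, C. Ikenmeyer, V. Lysikov, *Algebraic
metacomplexity and representation theory*, arXiv:2411.03444. §4 (p.12–13, PDF pp.13–14): the
action of `GL_k` on `ℂ[x₁,…,x_k]_d` induces the action of the Lie algebra `gl_k` and of its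
universal enveloping algebra `U(gl_k)` on the space of metapolynomials `ℂ[ℂ[x₁,…,x_k]_d]`;
p0029.txt:L41–L43: "By Claim 4.2, any element `X ∈ U(gl_k)` acts as a derivation on the space of
metapolynomials" [for `X ∈ gl_k`]; §5.1.1 (p0028:L17–L18): "The standard Cartan subalgebra consists
of all diagonal matrices, and we can take `H_i := E_{i,i}`."

## Tree rendering

* `gl_k` acts on forms `ℂ[x]_d = MvPolynomial (Fin k) ℂ` by the derivations
  `D_N = Σ_{a,c} N_{ac} x_a ∂_c` (the tree's `lieDer N`, `LMR13TangentIsotypic.lean`: the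
  infinitesimal form of the substitution `linSubst`, `x_c ↦ Σ_a g_{ac} x_a`), preserving each degree
  (`isHomogeneous_lieDer`), with `[D_M, D_N] = D_{MN−NM}` (`lie_lieDer`).
* **`lieOp k d N`** (Definition) — the induced action on metapolynomials
  `MvPolynomial (DegIdx (Fin k) d) ℂ` (polynomials in the coefficients `c_ν` of a degree-`d` form),
  the CONTRAGREDIENT of `D_N` on the coordinates: the derivation with
  `c_ν ↦ − Σ_μ [x^ν](D_N x^μ) · c_μ`. This is the derivative at `t = 0` of the tree's
  `coordRep (Fin k) ℂ d g_t`, `(g·F)(v) = F(g⁻¹ v)`, along `g_t⁻¹ = 1 + tN` (so `ġ_0 = −N`), i.e. the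
  action of `N ∈ gl_k` in the convention of `coordRep`; its diagonal part is `eulerOp`
  (`lieOp_diagonal`), whose eigenvalues on the weight spaces of `coordRep` are the weights
  (`mem_weightSpace_coordRep_iff_forall_eulerOp`, `BDGIL24WeightProjectorsEuler.lean`) — the
  consistency check of the sign convention available in the tree. The exponential / "Lie from group"
  comparison with `coordRep` itself is NOT typed here.
* `lieOp_X`, `lieOp_add`, `lieOp_smul`, `lieOp_zero` — values on coordinates, linearity in `N`;
  `coeff_lieDer_lieDer` — matrix of a composite `D_M D_N` on degree-`d` forms;
* **`lie_lieOp`** — `[lieOp M, lieOp N] = lieOp (MN − NM)`: `N ↦ lieOp N` is a Lie algebra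
  representation of `gl_k` by derivations (Claim 4.2);
* **`lieOp_diagonal`** — `lieOp (diagonal c) = Σ_i c_i • E_i` with `E_i = eulerOp k d i`.

Honest framing: representation-theoretic plumbing for §5 (Casimirs `C_p`, `C_{ℓ,p}` of eq. (8)/(14)
and Thm. 5.10 are polynomials in the `lieOp E_{ab}`; not typed). Nothing here bears on `VP ≠ VNP`.

## References
* [BergEtAl2024] arXiv:2411.03444, §4 Claim 4.2 (p.13), §5.1.1 (p.27), §5.2 (p.28).
* [LandsbergManivelRessayre2013] §3.4 (the derivations `D_N`, tree `lieDer`).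
-/

noncomputable section

open MvPolynomial
open scoped BigOperators

namespace Literature.Barriers.ValiantsHypothesis

namespace BergEtAl2024

open Literature.Computability.AlgebraicComplexity Literature.NumberTheory.DiophantineGeometry

variable {k d : ℕ}

/-! ### The action of `gl_k` on metapolynomials -/

/-- **The action of `N ∈ gl_k` on metapolynomials** `ℂ[ℂ[x₁,…,x_k]_d]` (Claim 4.2: by derivations),
in the convention of the tree's `coordRep` (`(g·F)(v) = F(g⁻¹ v)`): the derivation determined by
`c_ν ↦ −Σ_μ [x^ν](D_N x^μ) · c_μ`, where `D_N = Σ N_{ac} x_a ∂_c = lieDer N` is the action of `N` on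
forms of degree `d` and `[x^ν](·)` the coefficient of `x^ν`.
[cite: BergEtAl2024, §4 (Claim 4.2) and §5.2, p.28 (PDF p.29)] locator: paper:arxiv-2411.03444 p0029.txt:L41–L43 -/
def lieOp (k d : ℕ) (N : Matrix (Fin k) (Fin k) ℂ) :
    Derivation ℂ (MvPolynomial (DegIdx (Fin k) d) ℂ) (MvPolynomial (DegIdx (Fin k) d) ℂ) :=
  MvPolynomial.mkDerivation ℂ fun ν =>
    -∑ μ : DegIdx (Fin k) d, coeff ν.1 (lieDer N (monomial μ.1 (1 : ℂ))) • X μ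

/-- `lieOp N c_ν = −Σ_μ [x^ν](D_N x^μ) · c_μ`. [cite: BergEtAl2024, §4 (Claim 4.2), p.13 (PDF p.14)] -/
theorem lieOp_X (N : Matrix (Fin k) (Fin k) ℂ) (ν : DegIdx (Fin k) d) :
    lieOp k d N (X ν) =
      -∑ μ : DegIdx (Fin k) d, coeff ν.1 (lieDer N (monomial μ.1 (1 : ℂ))) • X μ :=
  MvPolynomial.mkDerivation_X _ _ _

/-- `N ↦ lieOp N` is additive. [cite: BergEtAl2024, §4 (Claim 4.2), p.13 (PDF p.14)] -/
theorem lieOp_add (M N : Matrix (Fin k) (Fin k) ℂ) :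
    lieOp k d (M + N) = lieOp k d M + lieOp k d N := by
  refine MvPolynomial.derivation_ext fun ν => ?_
  rw [Derivation.add_apply, lieOp_X, lieOp_X, lieOp_X, lieDer_add, ← neg_add,
    ← Finset.sum_add_distrib]
  congr 1
  exact Finset.sum_congr rfl fun μ _ => by
    rw [Derivation.add_apply, coeff_add, add_smul]

/-- `N ↦ lieOp N` is homogeneous. [cite: BergEtAl2024, §4 (Claim 4.2), p.13 (PDF p.14)] -/
theorem lieOp_smul (t : ℂ) (N : Matrix (Fin k) (Fin k) ℂ) :
    lieOp k d (t • N) = t • lieOp k d N := by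
  refine MvPolynomial.derivation_ext fun ν => ?_
  rw [Derivation.smul_apply, lieOp_X, lieOp_X, lieDer_smul, smul_neg, Finset.smul_sum]
  congr 1
  exact Finset.sum_congr rfl fun μ _ => by
    rw [Derivation.smul_apply, coeff_smul, smul_eq_mul, mul_smul]

/-- `lieOp 0 = 0`. [cite: BergEtAl2024, §4 (Claim 4.2), p.13 (PDF p.14)] -/
theorem lieOp_zero : lieOp k d (0 : Matrix (Fin k) (Fin k) ℂ) = 0 := by
  have h := lieOp_smul (k := k) (d := d) (0 : ℂ) 0
  rwa [zero_smul, zero_smul] at h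

/-! ### The matrix of `D_N` on degree-`d` forms and the representation property -/

/-- `D_N x^μ` is again a form of degree `d` (for `μ` of degree `d`).
[cite: BergEtAl2024, §4, p.13 (PDF p.14)] -/
theorem isHomogeneous_lieDer_monomial (N : Matrix (Fin k) (Fin k) ℂ) (μ : DegIdx (Fin k) d) :
    (lieDer N (monomial μ.1 (1 : ℂ))).IsHomogeneous d :=
  isHomogeneous_lieDer N (isHomogeneous_monomial _ (mem_degMonomials_iff.1 μ.2))

/-- **Matrix of a composite**: `[x^ν](D_M D_N x^λ) = Σ_μ [x^ν](D_M x^μ) · [x^μ](D_N x^λ)` (the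
degree-`d` monomials are a basis of the `D`-stable space of forms of degree `d`).
[cite: BergEtAl2024, §4, p.13 (PDF p.14)] -/
theorem coeff_lieDer_lieDer (M N : Matrix (Fin k) (Fin k) ℂ) (ν lam : DegIdx (Fin k) d) :
    coeff ν.1 (lieDer M (lieDer N (monomial lam.1 (1 : ℂ)))) =
      ∑ μ : DegIdx (Fin k) d, coeff ν.1 (lieDer M (monomial μ.1 (1 : ℂ))) *
        coeff μ.1 (lieDer N (monomial lam.1 (1 : ℂ))) := by
  conv_lhs => rw [← sum_coeff_smul_monomial_eq (isHomogeneous_lieDer_monomial N lam)]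
  rw [map_sum, coeff_sum]
  exact Finset.sum_congr rfl fun μ _ => by
    rw [Derivation.map_smul, coeff_smul, smul_eq_mul, mul_comm]

/-- **Claim 4.2 / the representation property: `N ↦ lieOp N` is a Lie algebra representation of
`gl_k` by derivations** — `[lieOp M, lieOp N] = lieOp (MN − NM)` (contragredient of
`[D_M, D_N] = D_{MN−NM}`, `lie_lieDer`). [cite: BergEtAl2024, §4 (Claim 4.2), p.13 (PDF p.14)] locator: paper:arxiv-2411.03444 p0029.txt:L41–L43 -/
theorem lie_lieOp (M N : Matrix (Fin k) (Fin k) ℂ) :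
    ⁅lieOp k d M, lieOp k d N⁆ = lieOp k d (M * N - N * M) := by
  refine MvPolynomial.derivation_ext fun ν => ?_
  -- both sides on the coordinate `c_ν`, as combinations of the `c_λ`
  have hcomp : ∀ (M N : Matrix (Fin k) (Fin k) ℂ),
      lieOp k d M (lieOp k d N (X ν)) =
        ∑ lam : DegIdx (Fin k) d, (∑ μ : DegIdx (Fin k) d,
          coeff ν.1 (lieDer N (monomial μ.1 (1 : ℂ))) *
            coeff μ.1 (lieDer M (monomial lam.1 (1 : ℂ)))) • (X lam : MvPolynomial _ ℂ) := by
    intro M N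
    rw [lieOp_X, map_neg, map_sum]
    simp only [Derivation.map_smul, lieOp_X, smul_neg, Finset.smul_sum, smul_smul,
      Finset.sum_neg_distrib, neg_neg]
    rw [Finset.sum_comm]
    exact Finset.sum_congr rfl fun lam _ => by rw [Finset.sum_smul]
  rw [Derivation.commutator_apply, hcomp, hcomp, lieOp_X, ← Finset.sum_sub_distrib,
    ← Finset.sum_neg_distrib]
  refine Finset.sum_congr rfl fun lam _ => ?_
  rw [← sub_smul, ← neg_smul]
  congr 1
  rw [← lie_lieDer, Derivation.commutator_apply, coeff_sub, coeff_lieDer_lieDer,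
    coeff_lieDer_lieDer, neg_sub]

/-! ### The Cartan part: diagonal matrices act by the `E_i` -/

/-- `D_{diag(c)} x^μ = (Σ_i c_i μ_i) · x^μ` (Euler). [cite: BergEtAl2024, §5.1.1, p.27 (PDF p.28)] -/
theorem lieDer_diagonal_monomial (c : Fin k → ℂ) (μ : (Fin k) →₀ ℕ) :
    lieDer (Matrix.diagonal c) (monomial μ (1 : ℂ)) =
      (∑ i, c i * (μ i : ℂ)) • monomial μ (1 : ℂ) := by
  classical
  rw [lieDer_apply_eq_sum, Finset.sum_smul]
  refine Finset.sum_congr rfl fun a _ => ?_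
  rw [Finset.sum_eq_single a]
  · rw [Matrix.diagonal_apply_eq, pderiv_monomial, one_mul]
    by_cases hμ : μ a = 0
    · rw [hμ, Nat.cast_zero, monomial_zero, mul_zero, smul_zero, mul_zero, zero_smul]
    · rw [X, monomial_mul, one_mul, add_tsub_cancel_of_le
        (Finsupp.single_le_iff.2 (Nat.one_le_iff_ne_zero.2 hμ)), smul_monomial, smul_monomial]
      simp only [smul_eq_mul, mul_one]
  · intro b _ hb
    rw [Matrix.diagonal_apply_ne _ (Ne.symm hb), zero_smul]
  · intro h
    exact absurd (Finset.mem_univ a) h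

/-- A finite sum of derivations, applied. [folklore] -/
private theorem derivation_sum_apply {ι A : Type*} [CommRing A] [Algebra ℂ A] (s : Finset ι)
    (D : ι → Derivation ℂ A A) (a : A) : (∑ i ∈ s, D i) a = ∑ i ∈ s, D i a := by
  classical
  induction s using Finset.induction_on with
  | empty => simp
  | insert x s hx ih => rw [Finset.sum_insert hx, Finset.sum_insert hx, Derivation.add_apply, ih]

/-- **The Cartan generators are the `E_i`**: `lieOp (diagonal c) = Σ_i c_i • eulerOp i`; in
particular `lieOp E_{i,i} = eulerOp k d i` ("we can take `H_i := E_{i,i}`").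
[cite: BergEtAl2024, §5.1.1, p.27 (PDF p.28)] locator: paper:arxiv-2411.03444 p0028.txt:L17–L18 -/
theorem lieOp_diagonal (c : Fin k → ℂ) :
    lieOp k d (Matrix.diagonal c) = ∑ i, c i • eulerOp k d i := by
  classical
  refine MvPolynomial.derivation_ext fun ν => ?_
  rw [lieOp_X, derivation_sum_apply, Finset.sum_eq_single ν]
  · rw [lieDer_diagonal_monomial, coeff_smul, coeff_monomial, if_pos rfl, smul_eq_mul, mul_one,
      ← neg_smul]
    simp only [Derivation.smul_apply, eulerOp_X, smul_smul]
    rw [← Finset.sum_smul]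
    congr 1
    rw [← Finset.sum_neg_distrib]
    exact Finset.sum_congr rfl fun i _ => by ring
  · intro μ _ hμ
    rw [lieDer_diagonal_monomial, coeff_smul, coeff_monomial,
      if_neg (fun h => hμ (Subtype.ext h)), smul_zero, zero_smul]
  · intro h
    exact absurd (Finset.mem_univ ν) h

/-- In particular `lieOp E_{i,i} = E_i`. [cite: BergEtAl2024, §5.1.1, p.27 (PDF p.28)] -/
theorem lieOp_single_eq_eulerOp (i : Fin k) :
    lieOp k d (Matrix.diagonal (Pi.single i (1 : ℂ))) = eulerOp k d i := by
  rw [lieOp_diagonal, Finset.sum_eq_single i]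
  · rw [Pi.single_eq_same, one_smul]
  · intro j _ hj
    rw [Pi.single_eq_of_ne hj, zero_smul]
  · intro h
    exact absurd (Finset.mem_univ i) h

end BergEtAl2024

end Literature.Barriers.ValiantsHypothesis
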